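import Mathlib
import Literature.Computability.Complexity.RangeAvoidance
import Literature.Computability.Complexity.SignDegreeXor
import Summits.PneNP.PneNP.Theorems.PstarTyped
import Summits.PneNP.PneNP.Theorems.PstarSALevel
import Summits.PneNP.PneNP.Theorems.PstarSAClosure

/-!
# Random typed `P⋆` instances, I: the model, vertex expansion ⇒ boundary expansion, and the bad-set containment

FRONTIER range-avoidance ladder, ROUND-21 item T21.1′ (cell `pnp-ideate`; restricted-model combinatorics — nothing here
bears on `P` vs `NP`).  Towards the EXISTENCE of boundary-expanding typed pure-`P⋆` instances at every linear stretch
(`PstarExpandingExist`), by the first-moment method done as plain counting.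

* The model: an OUTCOME `ω : Fin m → DPair N × DPair N` assigns to every output an ordered pair of distinct XOR variables
  and an ordered pair of distinct AND variables; `inst ω : LocalMap 4 (N + N) m` is the typed pure `P⋆` instance reading
  the XOR pair on the left copy and the AND pair on the right copy (`isPure_inst`, `typed_inst`).
* `two_card_nbhd_le`: for an instance with injective positions, `2·|N(J)| ≤ |bdry J| + k·|J|` (degree counting), hence
  `boundaryExpanding_of_vertexExpanding`: `(∀ |J| ≤ r, 11·|J| ≤ 4·|N(J)|) ⇒ BoundaryExpanding r` for `k = 4`.
* `exists_pair_of_small_nbhd`: if `|N(J)| ≤ v ≤ N` for `inst ω` then for some `A, B ⊆ Fin N` with `|A| + |B| = v` every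
  output of `J` has its XOR pair inside `A` and its AND pair inside `B` — the containment behind the union bound.
-/

set_option linter.dupNamespace false

open Finset Literature.Computability.Complexity
open Summit.PneNP.PneNP.Theorems.PstarTyped (Typed)
open Summit.PneNP.PneNP.Theorems.PstarSALevel (varSet bdry BoundaryExpanding)
open Summit.PneNP.PneNP.Theorems.PstarSAClosure (nbhd degIn mem_bdry_iff mem_nbhd)

namespace Summit.PneNP.PneNP.Theorems.PstarExpandingModel

variable {k n m N : ℕ}

/-! ## Degree counting: vertex expansion gives boundary expansion -/

/-- With injective positions an output reads exactly `k` variables. -/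
theorem card_varSet_eq (I : LocalMap k n m) (hI : ∀ j, Function.Injective (I.vars j)) (j : Fin m) :
    (varSet I j).card = k := by
  unfold PstarSALevel.varSet
  rw [Finset.card_image_of_injective _ (hI j), Finset.card_univ, Fintype.card_fin]

/-- Double counting of incidences: `Σ_{v ∈ N(J)} deg_J(v) = k·|J|`. -/
theorem sum_degIn_eq (I : LocalMap k n m) (hI : ∀ j, Function.Injective (I.vars j)) (J : Finset (Fin m)) :
    ∑ v ∈ nbhd I J, degIn I J v = k * J.card := by
  classical
  have h1 : ∀ v, degIn I J v = ∑ j ∈ J, if v ∈ varSet I j then 1 else 0 := fun v => by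
    unfold PstarSAClosure.degIn; rw [Finset.card_filter]
  simp_rw [h1]
  rw [Finset.sum_comm]
  have h2 : ∀ j ∈ J, (∑ v ∈ nbhd I J, if v ∈ varSet I j then 1 else 0) = k := by
    intro j hj
    rw [← Finset.card_filter, Finset.filter_mem_eq_inter,
      Finset.inter_eq_right.2 (fun v hv => mem_nbhd I hj hv), card_varSet_eq I hI j]
  rw [Finset.sum_congr rfl h2, Finset.sum_const, smul_eq_mul, Nat.mul_comm]

/-- A variable of `N(J)` is read by at least one output of `J`, and by at least two unless it is a boundary variable. -/
theorem two_le_degIn_add (I : LocalMap k n m) (J : Finset (Fin m)) (v : Fin n) (hv : v ∈ nbhd I J) :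
    2 ≤ degIn I J v + (if v ∈ bdry I J then 1 else 0) := by
  classical
  have hpos : 0 < degIn I J v := by
    obtain ⟨j, hj, hvj⟩ := Finset.mem_biUnion.1 hv
    unfold PstarSAClosure.degIn
    exact Finset.card_pos.2 ⟨j, Finset.mem_filter.2 ⟨hj, hvj⟩⟩
  by_cases hb : v ∈ bdry I J
  · rw [if_pos hb]; omega
  · rw [if_neg hb, mem_bdry_iff] at *
    omega

/-- **`2·|N(J)| ≤ |bdry J| + k·|J|`** for instances with injective positions. -/
theorem two_card_nbhd_le (I : LocalMap k n m) (hI : ∀ j, Function.Injective (I.vars j)) (J : Finset (Fin m)) :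
    2 * (nbhd I J).card ≤ (bdry I J).card + k * J.card := by
  classical
  have h := Finset.sum_le_sum fun v hv => two_le_degIn_add I J v hv
  rw [Finset.sum_const, smul_eq_mul, Finset.sum_add_distrib, sum_degIn_eq I hI J, ← Finset.card_filter] at h
  have : ((nbhd I J).filter fun v => v ∈ bdry I J).card ≤ (bdry I J).card :=
    Finset.card_le_card fun v hv => (Finset.mem_filter.1 hv).2
  omega

/-- **Vertex expansion ⇒ boundary expansion** (`k = 4`): if every `≤ r` outputs read at least `11/4·|J|` variables then
the instance is `(r, 3/2)`-boundary expanding. -/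
theorem boundaryExpanding_of_vertexExpanding (I : LocalMap 4 n m) (hI : ∀ j, Function.Injective (I.vars j)) (r : ℕ)
    (h : ∀ J : Finset (Fin m), J.card ≤ r → 11 * J.card ≤ 4 * (nbhd I J).card) : BoundaryExpanding r I := by
  intro J hJ
  have h1 := h J hJ
  have h2 := two_card_nbhd_le I hI J
  omega

/-! ## The model -/

/-- Ordered pairs of distinct points of `Fin N`. -/
abbrev DPair (N : ℕ) : Type := {p : Fin N × Fin N // p.1 ≠ p.2}

/-- An outcome: for every output an XOR pair and an AND pair. -/
abbrev Outcome (N m : ℕ) : Type := Fin m → DPair N × DPair N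

/-- The four positions of an output: XOR pair on the left copy, AND pair on the right copy of the variables. -/
def slots (N : ℕ) (q : DPair N × DPair N) (s : Fin 4) : Fin (N + N) :=
  if s.val = 0 then Fin.castAdd N q.1.1.1 else if s.val = 1 then Fin.castAdd N q.1.1.2
  else if s.val = 2 then Fin.natAdd N q.2.1.1 else Fin.natAdd N q.2.1.2

/-- Slot `0`. -/
theorem slots_zero (q : DPair N × DPair N) : slots N q 0 = Fin.castAdd N q.1.1.1 := rfl

/-- Slot `1`. -/
theorem slots_one (q : DPair N × DPair N) : slots N q 1 = Fin.castAdd N q.1.1.2 := rfl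

/-- Slot `2`. -/
theorem slots_two (q : DPair N × DPair N) : slots N q 2 = Fin.natAdd N q.2.1.1 := rfl

/-- Slot `3`. -/
theorem slots_three (q : DPair N × DPair N) : slots N q 3 = Fin.natAdd N q.2.1.2 := rfl

/-- **The instance of an outcome**: typed pure `P⋆` on `N + N` variables. -/
def inst (ω : Outcome N m) : LocalMap 4 (N + N) m where
  vars j := slots N (ω j)
  table _ := xorAndPred

/-- XOR slots read the left copy. -/
theorem slots_val_lt (q : DPair N × DPair N) (s : Fin 4) (hs : s.val < 2) : (slots N q s).val < N := by
  fin_cases s <;> simp [slots] at hs ⊢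

/-- AND slots read the right copy. -/
theorem le_slots_val (q : DPair N × DPair N) (s : Fin 4) (hs : 2 ≤ s.val) : N ≤ (slots N q s).val := by
  fin_cases s <;> simp [slots] at hs ⊢

/-- A left position is not a right position. -/
theorem castAdd_ne_natAdd (a c : Fin N) : Fin.castAdd N a ≠ Fin.natAdd N c := by
  intro h
  have := congrArg Fin.val h
  simp at this
  omega

/-- The four positions of an output are distinct. -/
theorem slots_injective (q : DPair N × DPair N) : Function.Injective (slots N q) := by
  have ha : (q.1.1.1).val ≠ (q.1.1.2).val := fun h => q.1.2 (Fin.ext h)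
  have hc : (q.2.1.1).val ≠ (q.2.1.2).val := fun h => q.2.2 (Fin.ext h)
  have h1 := (q.1.1.1).isLt
  have h2 := (q.1.1.2).isLt
  intro s t h
  have hv := congrArg Fin.val h
  fin_cases s <;> fin_cases t <;> simp [slots] at hv <;> first | rfl | (exfalso; omega)

/-- The instance of an outcome is pure `P⋆`. -/
theorem isPure_inst (ω : Outcome N m) : (inst ω).IsPure xorAndPred := ⟨fun _ => rfl, fun j => slots_injective (ω j)⟩

/-- The instance of an outcome is typed. -/
theorem typed_inst (ω : Outcome N m) : Typed (inst ω) := by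
  intro j j' s t hs ht h
  have h1 := slots_val_lt (ω j) s hs
  have h2 := le_slots_val (ω j') t ht
  have := congrArg Fin.val h
  change (slots N (ω j) s).val = (slots N (ω j') t).val at this
  omega

/-! ## The bad-set containment -/

/-- The XOR variables read by `J`. -/
def xvars (ω : Outcome N m) (J : Finset (Fin m)) : Finset (Fin N) := J.biUnion fun j => {(ω j).1.1.1, (ω j).1.1.2}

/-- The AND variables read by `J`. -/
def avars (ω : Outcome N m) (J : Finset (Fin m)) : Finset (Fin N) := J.biUnion fun j => {(ω j).2.1.1, (ω j).2.1.2}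

/-- `N(J)` of the instance is the left copy of `xvars` together with the right copy of `avars`. -/
theorem nbhd_inst_eq (ω : Outcome N m) (J : Finset (Fin m)) :
    nbhd (inst ω) J = (xvars ω J).image (Fin.castAdd N) ∪ (avars ω J).image (Fin.natAdd N) := by
  ext v
  simp only [PstarSAClosure.nbhd, PstarSALevel.varSet, Finset.mem_biUnion, Finset.mem_image, Finset.mem_univ,
    true_and, Finset.mem_union, xvars, avars, Finset.mem_insert, Finset.mem_singleton]
  constructor
  · rintro ⟨j, hj, s, hs⟩
    change slots N (ω j) s = v at hs
    fin_cases s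
    · exact Or.inl ⟨_, ⟨j, hj, Or.inl rfl⟩, hs⟩
    · exact Or.inl ⟨_, ⟨j, hj, Or.inr rfl⟩, hs⟩
    · exact Or.inr ⟨_, ⟨j, hj, Or.inl rfl⟩, hs⟩
    · exact Or.inr ⟨_, ⟨j, hj, Or.inr rfl⟩, hs⟩
  · rintro (⟨a, ⟨j, hj, rfl | rfl⟩, rfl⟩ | ⟨c, ⟨j, hj, rfl | rfl⟩, rfl⟩)
    · exact ⟨j, hj, 0, rfl⟩
    · exact ⟨j, hj, 1, rfl⟩
    · exact ⟨j, hj, 2, rfl⟩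
    · exact ⟨j, hj, 3, rfl⟩

/-- `|N(J)| = |xvars| + |avars|`. -/
theorem card_nbhd_inst (ω : Outcome N m) (J : Finset (Fin m)) :
    (nbhd (inst ω) J).card = (xvars ω J).card + (avars ω J).card := by
  rw [nbhd_inst_eq, Finset.card_union_of_disjoint, Finset.card_image_of_injective _ (Fin.castAdd_injective _ _),
    Finset.card_image_of_injective _ (Fin.natAdd_injective _ _)]
  rw [Finset.disjoint_left]
  rintro v hv hv'
  obtain ⟨a, -, rfl⟩ := Finset.mem_image.1 hv
  obtain ⟨c, -, hc⟩ := Finset.mem_image.1 hv'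
  exact castAdd_ne_natAdd a c hc.symm

/-- The outcomes at output `j` whose XOR pair lies in `A` and AND pair in `B`. -/
def qset (A B : Finset (Fin N)) : Finset (DPair N × DPair N) :=
  univ.filter fun q => q.1.1.1 ∈ A ∧ q.1.1.2 ∈ A ∧ q.2.1.1 ∈ B ∧ q.2.1.2 ∈ B

/-- **Containment.**  If `|N(J)| ≤ v ≤ N` then some `A, B ⊆ Fin N` with `|A| + |B| = v` contain every XOR pair resp. AND
pair of the outputs of `J`. -/
theorem exists_pair_of_small_nbhd (ω : Outcome N m) (J : Finset (Fin m)) (v : ℕ) (hvN : v ≤ N)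
    (h : (nbhd (inst ω) J).card ≤ v) :
    ∃ A B : Finset (Fin N), A.card + B.card = v ∧ ∀ j ∈ J, ω j ∈ qset A B := by
  rw [card_nbhd_inst] at h
  obtain ⟨A, hXA, -, hA⟩ := Finset.exists_subsuperset_card_eq (Finset.subset_univ (xvars ω J))
    (show (xvars ω J).card ≤ v - (avars ω J).card by omega) (by simp; omega)
  refine ⟨A, avars ω J, by omega, fun j hj => ?_⟩
  simp only [qset, Finset.mem_filter, Finset.mem_univ, true_and]
  have hx : ∀ a, a ∈ ({(ω j).1.1.1, (ω j).1.1.2} : Finset (Fin N)) → a ∈ A :=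
    fun a ha => hXA (Finset.mem_biUnion.2 ⟨j, hj, ha⟩)
  have hy : ∀ c, c ∈ ({(ω j).2.1.1, (ω j).2.1.2} : Finset (Fin N)) → c ∈ avars ω J :=
    fun c hc => Finset.mem_biUnion.2 ⟨j, hj, hc⟩
  exact ⟨hx _ (by simp), hx _ (by simp), hy _ (by simp), hy _ (by simp)⟩

/-- Size of `qset`: at most `(|A|·|B|)²`, and `16·|qset A B| ≤ (|A| + |B|)⁴`. -/
theorem card_qset_le (A B : Finset (Fin N)) : (qset A B).card ≤ (A.card * B.card) ^ 2 := by
  classical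
  -- inject into (A × A) × (B × B)
  have : (qset A B).card ≤ ((A ×ˢ A) ×ˢ (B ×ˢ B)).card := by
    refine Finset.card_le_card_of_injOn (fun q => ((q.1.1.1, q.1.1.2), (q.2.1.1, q.2.1.2))) ?_ ?_
    · intro q hq
      simp only [qset, Finset.coe_filter, Set.mem_setOf_eq, Finset.mem_univ, true_and] at hq
      simp [hq.1, hq.2.1, hq.2.2.1, hq.2.2.2]
    · intro q _ q' _ h
      simp only [Prod.mk.injEq] at h
      obtain ⟨⟨h1, h2⟩, h3, h4⟩ := h
      exact Prod.ext (Subtype.ext (Prod.ext h1 h2)) (Subtype.ext (Prod.ext h3 h4))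
  refine this.trans ?_
  rw [Finset.card_product, Finset.card_product, Finset.card_product]
  nlinarith

/-- `16·(ab)² ≤ (a + b)⁴`. -/
theorem sixteen_mul_sq_le (a b : ℕ) : 16 * (a * b) ^ 2 ≤ (a + b) ^ 4 := by
  have h : 4 * (a * b) ≤ (a + b) ^ 2 := by
    have hz : (4 * (a * b) : ℤ) ≤ ((a : ℤ) + b) ^ 2 := by nlinarith [sq_nonneg ((a : ℤ) - b)]
    exact_mod_cast hz
  calc 16 * (a * b) ^ 2 = (4 * (a * b)) ^ 2 := by ring
    _ ≤ ((a + b) ^ 2) ^ 2 := Nat.pow_le_pow_left h 2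
    _ = (a + b) ^ 4 := by ring

end Summit.PneNP.PneNP.Theorems.PstarExpandingModel
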